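import Summits.QuantumFields.YangMills.Theorems.IR.SCFloorSliceTerms

/-!
# Strong-coupling floor engine, part 19: the plaquette slice sums — floor at time one, ceiling at time zero

Pooled prover `ym-ir-line-bsf-p1` (crux `IR`, stmt-QuantumFields-19354), support for the consumer rung R2 of line
`momentum-pincer` (`NoLightMoversSCTransfer`).  With `P = plaquetteObs ρ 0 1 2` and the slice sum
`s_S(t) = Σ_{x⃗ ∈ (ℤ/(2S+1))³} Corr_{2S+1}(P∘θ_{(0,x̃)}, P; t)` (= `sliceSumCorr ρ β S P P t` of `Lines/momentum_pincer.lean`,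
written out):
* `sliceSum_one_floor` — `κ β⁴ ≤ s_S(1)` for `0 < β ≤ β₀`, all `S ≥ 1` (`κ = c/2`, `c` the diagonal floor of part 11;
  the off-diagonal terms are `O(β⁵)` uniformly by part 18 and the lattice sums of part 17);
* `abs_sliceSum_zero_le` — `|s_S(0)| ≤ V` for `0 ≤ β ≤ β₀`, all `S ≥ 1`.
HONEST: strong coupling only; nothing here bears on the Yang–Mills mass gap.
-/

set_option autoImplicit false

noncomputable section

open MeasureTheory Filter Topology Function Finset
open Literature.MathematicalPhysics.QuantumFieldTheory
open Literature.MathematicalPhysics.QuantumLattice (plaquetteObs torusLift toTorusObservable configShift configShift_apply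
  LGConfig)

namespace Summit.QuantumFields.YangMills.Cruxes.IR.SCFloor

variable {G : Type} [Group G] [TopologicalSpace G] [IsTopologicalGroup G] [CompactSpace G] [MeasurableSpace G]
  [BorelSpace G] {N : ℕ} (ρ : G →* Matrix (Fin N) (Fin N) ℂ)

/-- The `x⃗ = 0⃗` term of the slice sum is the unshifted correlator. -/
theorem sliceTerm_zero (S : ℕ) (β : ℝ) (A B : LGConfig 4 G → ℝ) (t : ℕ) :
    latticeConnectedCorr ρ β (2 * S + 1)
        (fun U => A (configShift (fun i : Fin 4 => if h : i = 0 then (0 : ℤ) else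
          (((0 : Fin 3 → ZMod (2 * S + 1)) (i.pred h)).valMinAbs : ℤ)) U)) B t =
      latticeConnectedCorr ρ β (2 * S + 1) A B t := by
  have h0 : (fun i : Fin 4 => if h : i = 0 then (0 : ℤ) else (((0 : Fin 3 → ZMod (2 * S + 1)) (i.pred h)).valMinAbs : ℤ)) =
      (0 : Literature.Probability.LatticeModels.Site 4) := by
    funext i; by_cases h : i = 0 <;> simp [h]
  have hid : ∀ U : LGConfig 4 G, configShift (0 : Literature.Probability.LatticeModels.Site 4) U = U := fun U => by
    funext e; simp [configShift_apply]
  simp only [h0, hid]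

/-- **Ceiling at time zero**: `|s_S(0)| ≤ V` uniformly in `S ≥ 1` and `0 ≤ β ≤ β₀`. -/
theorem abs_sliceSum_zero_le (hρ : Continuous ρ) :
    ∃ β₀ V : ℝ, 0 < β₀ ∧ 0 < V ∧ ∀ (S : ℕ), 1 ≤ S → ∀ β : ℝ, 0 ≤ β → β ≤ β₀ →
      |∑ xs : Fin 3 → ZMod (2 * S + 1), latticeConnectedCorr ρ β (2 * S + 1)
          (fun U => plaquetteObs ρ (0 : Literature.Probability.LatticeModels.Site 4) 1 2
            (configShift (fun i : Fin 4 => if h : i = 0 then (0 : ℤ) else ((xs (i.pred h)).valMinAbs : ℤ)) U))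
          (plaquetteObs ρ (0 : Literature.Probability.LatticeModels.Site 4) 1 2) 0| ≤ V := by
  obtain ⟨β₀, M, hβ₀, hM, hterm⟩ := equalTime_term_bound ρ hρ
  refine ⟨β₀, 64 * M + 1, hβ₀, by positivity, fun S hS β hβ0 hβ => ?_⟩
  refine (Finset.abs_sum_le_sum_abs _ _).trans ?_
  calc ∑ xs : Fin 3 → ZMod (2 * S + 1), |latticeConnectedCorr ρ β (2 * S + 1)
          (fun U => plaquetteObs ρ (0 : Literature.Probability.LatticeModels.Site 4) 1 2
            (configShift (fun i : Fin 4 => if h : i = 0 then (0 : ℤ) else ((xs (i.pred h)).valMinAbs : ℤ)) U))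
          (plaquetteObs ρ (0 : Literature.Probability.LatticeModels.Site 4) 1 2) 0|
      ≤ ∑ xs : Fin 3 → ZMod (2 * S + 1), M * ∏ i : Fin 3, ((1 : ℝ) / 2) ^ ((xs i).valMinAbs).natAbs :=
        Finset.sum_le_sum fun xs _ => hterm S hS β hβ0 hβ xs
    _ = M * ∑ xs : Fin 3 → ZMod (2 * S + 1), ∏ i : Fin 3, ((1 : ℝ) / 2) ^ ((xs i).valMinAbs).natAbs := by
        rw [Finset.mul_sum]
    _ ≤ M * 64 := mul_le_mul_of_nonneg_left (sum_spatial_weight_le _) hM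
    _ ≤ 64 * M + 1 := by linarith

variable [SecondCountableTopology G] [T2Space G]

/-- **Floor at time one**: `κ β⁴ ≤ s_S(1)` for `0 < β ≤ β₀`, uniformly in `S ≥ 1` — the diagonal term is
`≥ c β⁴` (part 11), the others sum to `O(β⁵)` (parts 17, 18). -/
theorem sliceSum_one_floor (hρ : Continuous ρ) (hnc : ∃ g h : G, (ρ g).trace.re ≠ (ρ h).trace.re) :
    ∃ β₀ κ : ℝ, 0 < β₀ ∧ 0 < κ ∧ ∀ (S : ℕ), 1 ≤ S → ∀ β : ℝ, 0 < β → β ≤ β₀ →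
      κ * β ^ 4 ≤ ∑ xs : Fin 3 → ZMod (2 * S + 1), latticeConnectedCorr ρ β (2 * S + 1)
          (fun U => plaquetteObs ρ (0 : Literature.Probability.LatticeModels.Site 4) 1 2
            (configShift (fun i : Fin 4 => if h : i = 0 then (0 : ℤ) else ((xs (i.pred h)).valMinAbs : ℤ)) U))
          (plaquetteObs ρ (0 : Literature.Probability.LatticeModels.Site 4) 1 2) 1 := by
  classical
  obtain ⟨β₁, c, C, hβ₁, hc, -, hfloor⟩ := facingPlaquetteCorr_floor ρ hρ hnc
  obtain ⟨β₂, M, hβ₂, hM, hoff⟩ := offdiag_term_bound ρ hρ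
  refine ⟨min β₁ (min β₂ (c / (128 * M + 1))), c / 2, by positivity, by positivity, fun S hS β hβ hβle => ?_⟩
  have hb₁ : β ≤ β₁ := hβle.trans (min_le_left _ _)
  have hb₂ : β ≤ β₂ := hβle.trans ((min_le_right _ _).trans (min_le_left _ _))
  have hb₃ : β ≤ c / (128 * M + 1) := hβle.trans ((min_le_right _ _).trans (min_le_right _ _))
  have h3 : 3 ≤ 2 * S + 1 := by omega
  set T : (Fin 3 → ZMod (2 * S + 1)) → ℝ := fun xs => latticeConnectedCorr ρ β (2 * S + 1)
      (fun U => plaquetteObs ρ (0 : Literature.Probability.LatticeModels.Site 4) 1 2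
        (configShift (fun i : Fin 4 => if h : i = 0 then (0 : ℤ) else ((xs (i.pred h)).valMinAbs : ℤ)) U))
      (plaquetteObs ρ (0 : Literature.Probability.LatticeModels.Site 4) 1 2) 1 with hT
  change c / 2 * β ^ 4 ≤ ∑ xs, T xs
  -- the diagonal term
  have hdiag : c * β ^ 4 ≤ T 0 := by
    simp only [hT]
    rw [sliceTerm_zero]
    exact (hfloor (2 * S + 1) h3 β hβ hb₁).1
  -- the off-diagonal terms
  have hrest : |∑ xs ∈ (Finset.univ : Finset (Fin 3 → ZMod (2 * S + 1))).erase 0, T xs| ≤ 64 * M * β ^ 5 := by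
    refine (Finset.abs_sum_le_sum_abs _ _).trans ?_
    calc ∑ xs ∈ (Finset.univ : Finset (Fin 3 → ZMod (2 * S + 1))).erase 0, |T xs|
        ≤ ∑ xs ∈ (Finset.univ : Finset (Fin 3 → ZMod (2 * S + 1))).erase 0,
            M * β ^ 5 * ∏ i : Fin 3, ((1 : ℝ) / 2) ^ ((xs i).valMinAbs).natAbs :=
          Finset.sum_le_sum fun xs hxs => hoff S hS β hβ.le hb₂ xs (Finset.ne_of_mem_erase hxs)
      _ ≤ ∑ xs : Fin 3 → ZMod (2 * S + 1), M * β ^ 5 * ∏ i : Fin 3, ((1 : ℝ) / 2) ^ ((xs i).valMinAbs).natAbs :=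
          Finset.sum_le_sum_of_subset_of_nonneg (Finset.erase_subset _ _) fun _ _ _ => by positivity
      _ = M * β ^ 5 * ∑ xs : Fin 3 → ZMod (2 * S + 1), ∏ i : Fin 3, ((1 : ℝ) / 2) ^ ((xs i).valMinAbs).natAbs := by
          rw [Finset.mul_sum]
      _ ≤ M * β ^ 5 * 64 := mul_le_mul_of_nonneg_left (sum_spatial_weight_le _) (by positivity)
      _ = 64 * M * β ^ 5 := by ring
  rw [← Finset.add_sum_erase _ _ (Finset.mem_univ (0 : Fin 3 → ZMod (2 * S + 1)))]
  have hsmall : 64 * M * β ^ 5 ≤ c / 2 * β ^ 4 := by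
    have h1 : β * (128 * M + 1) ≤ c := by rwa [le_div_iff₀ (by positivity)] at hb₃
    have hβ4 : 0 ≤ β ^ 4 := by positivity
    nlinarith [mul_le_mul_of_nonneg_right h1 hβ4, hM, hβ.le]
  have hlow := (abs_le.1 hrest).1
  linarith

end Summit.QuantumFields.YangMills.Cruxes.IR.SCFloor

end
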